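import Literature.Geometry.Kaehler.ComplexTorusHodgeDecomposition
import Literature.Analysis.Complex.PQMonomials
import Literature.LinearAlgebra.Alternating.WedgeWordsBasis
import Literature.LinearAlgebra.Alternating.WedgeWordsSorted
import Mathlib.Order.Hom.PowersetCard
import Mathlib.Data.Nat.Choose.Vandermonde
import Mathlib.LinearAlgebra.Complex.FiniteDimensional
import HarnessLib

/-!
# `dim_ℂ Λ^{p,q}(E) = C(g,p)·C(g,q)`: the pointwise Hodge numbers

For a complex vector space `E` of dimension `g`, the space `Λ^{p,q} ⊆ Alt^k_ℝ(E; ℂ)` of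
complex-valued real-multilinear alternating `k`-forms of type `(p,q)` (the tree's
`Literature.Analysis.Complex.typeSubmodule E k p q`, file `Analysis/Complex/PQTypes.lean`) has
dimension `C(g,p)·C(g,q)` for `p + q = k`: it is `⋀ᵖΩ ⊗ ⋀^qΩ̄`, `Ω = Hom_ℂ(E, ℂ)`, with basis the
monomials `dv_I ∧ dv̄_J`, `#I = p`, `#J = q` (Lange–Birkenhake, *Complex Abelian Varieties*, §1.1.5,
Lemma 1.1.22 and the isomorphism `⋀ᵖΩ ⊗ ⋀^qΩ̄ → IF^{p,q}(X)` before Prop. 1.1.23, held copy PDF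
pp. 25–26; Voisin (2002), §2.3.1 eq. (2.4) `Λ^{p,q} = ⋀ᵖ V^{1,0*} ⊗ ⋀^q V^{0,1*}`). This discharges the
named fact `HodgeTheory.finrank_typeSubmodule_eq_choose` of
`Literature/AlgebraicGeometry/HodgeTheory/ComplexTorusHodgeNumbers.lean` (its `_holds` is appended
there) and hence gives the Hodge numbers `h^{p,q} = C(g,p)·C(g,q)` of every complex torus.

## Proof (a dimension squeeze; no explicit independence computation)

* `Alt^k_ℝ(E; ℂ) = ⨁_{p+q=k} Λ^{p,q}` (the tree's `isInternal_typeSubmodule`), so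
  `∑_{p+q=k} dim Λ^{p,q} = dim_ℂ Alt^k_ℝ(E; ℂ) = C(2g, k)` (`finrank_alt_real_complex`, from the tree's
  basis of increasing monomials of a real dual frame, `LinearAlgebra.Alternating.finrank_eq_card_strictMono`,
  and the count `card_strictMono_fin_eq_choose`);
* `Λ^{p,q}` is spanned by the monomials `dz_P ∧ dz̄_Q` (the tree's `typeSubmodule_eq_span_pqWord`),
  and by alternation already by those of the REPRESENTATIVE words `appendWord u w` — an increasing
  `dz`-word `u` of length `p` followed by an increasing `dz̄`-word `w` of length `q`
  (`exists_appendWord_perm`, `typeSubmodule_eq_span_pqWord_appendWord`, via the tree's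
  `span_wedgeWord_image_eq_of_representatives`) — whence `dim Λ^{p,q} ≤ C(g,p)·C(g,q)`
  (`finrank_typeSubmodule_le`);
* Vandermonde `∑_{p+q=k} C(g,p)C(g,q) = C(2g,k)` (Mathlib `Nat.add_choose_eq`) turns the termwise
  inequalities into equalities (`Finset.sum_eq_sum_iff_of_le`): **`finrank_typeSubmodule`**.

## References

* H. Lange, *Abelian Varieties over the Complex Numbers*, Grundlehren Text Editions (2023) — the
  text actually held as `book:lange1992-complex-abelian-varieties` (lane ruling TRIBUNAL-A §5, key of
  record): every "PDF p." locator and every §1.1 theorem number in this file is of THIS edition;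
  §1.1.5 Thm. 1.1.21 (b), Lemma 1.1.22, Prop. 1.1.23 (PDF pp. 24–26). [Lange2023AbelianVarietiesComplex]
* H. Lange, Ch. Birkenhake, *Complex Abelian Varieties*, Grundlehren 302 (1992), §1.1 (first
  edition of the same text; "Lange–Birkenhake" in the docstrings below). [LangeBirkenhake1992]
* C. Voisin, *Hodge Theory and Complex Algebraic Geometry I* (2002), §2.3.1 eq. (2.4). [Voisin2002]
-/

noncomputable section

open Module Function Finset

namespace Literature.Analysis.Complex

open Literature.LinearAlgebra.Alternating Literature.Geometry.Kaehler
  Literature.NumberTheory.Transcendental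

/-! ### Counting increasing words -/

/-- Increasing words of length `k` in a linearly ordered alphabet of `m` letters are counted by
`C(m, k)` (order embeddings `Fin k ↪o ι` ↔ `k`-subsets, Mathlib `Set.powersetCard.ofFinEmbEquiv`).
[folklore] -/
private theorem card_strictMono_eq_choose' (ι : Type*) [Fintype ι] [LinearOrder ι] (k : ℕ) :
    Fintype.card {w : Fin k → ι // StrictMono w} = (Fintype.card ι).choose k := by
  let e : {w : Fin k → ι // StrictMono w} ≃ (Fin k ↪o ι) :=
    { toFun := fun w ↦ OrderEmbedding.ofStrictMono w.1 w.2
      invFun := fun f ↦ ⟨f, f.strictMono⟩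
      left_inv := fun _ ↦ rfl
      right_inv := fun _ ↦ by ext; rfl }
  rw [Fintype.card_congr (e.trans Set.powersetCard.ofFinEmbEquiv), ← Nat.card_eq_fintype_card,
    Set.powersetCard.card, Nat.card_eq_fintype_card]

/-! ### Letter counts are permutation invariant; the representative words `dz_U ∧ dz̄_W` -/

section Words

variable {ι : Type*}

/-- `#dz` of a reordered word. [folklore] -/
private theorem holCount_comp_perm {k : ℕ} (w : Fin k → ι × Bool) (π : Equiv.Perm (Fin k)) :
    holCount (w ∘ π) = holCount w :=
  Equiv.sum_comp π (fun i ↦ if (w i).2 then 0 else 1)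

/-- `#dz̄` of a reordered word. [folklore] -/
private theorem barCount_comp_perm {k : ℕ} (w : Fin k → ι × Bool) (π : Equiv.Perm (Fin k)) :
    barCount (w ∘ π) = barCount w :=
  Equiv.sum_comp π (fun i ↦ if (w i).2 then 1 else 0)

/-- **The representative word** `dz_{u 0} ⋯ dz_{u (p-1)} dz̄_{w 0} ⋯ dz̄_{w (q-1)}`: a `dz`-word `u`
followed by a `dz̄`-word `w` (Lange–Birkenhake's `dv_I ∧ dv̄_J`).
[cite: Lange2023AbelianVarietiesComplex, §1.1.5 Prop. 1.1.23 (PDF p. 25)] -/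
def appendWord {p q : ℕ} (u : Fin p → ι) (w : Fin q → ι) : Fin (p + q) → ι × Bool :=
  Fin.append (fun i ↦ (u i, false)) (fun j ↦ (w j, true))

/-- Letters of `appendWord` in the first block. [folklore] -/
@[simp] private theorem appendWord_castAdd {p q : ℕ} (u : Fin p → ι) (w : Fin q → ι) (i : Fin p) :
    appendWord u w (Fin.castAdd q i) = (u i, false) := by
  simp [appendWord]

/-- Letters of `appendWord` in the second block. [folklore] -/
@[simp] private theorem appendWord_natAdd {p q : ℕ} (u : Fin p → ι) (w : Fin q → ι) (j : Fin q) :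
    appendWord u w (Fin.natAdd p j) = (w j, true) := by
  simp [appendWord]

/-- `#dz (dz_U ∧ dz̄_W) = #U`. [folklore] -/
private theorem holCount_appendWord {p q : ℕ} (u : Fin p → ι) (w : Fin q → ι) :
    holCount (appendWord u w) = p := by
  rw [holCount, Fin.sum_univ_add]
  simp

/-- `#dz̄ (dz_U ∧ dz̄_W) = #W`. [folklore] -/
private theorem barCount_appendWord {p q : ℕ} (u : Fin p → ι) (w : Fin q → ι) :
    barCount (appendWord u w) = q := by
  rw [barCount, Fin.sum_univ_add]
  simp

/-- `#dz` of a word is the number of its `dz`-positions. [folklore] -/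
private theorem holCount_eq_card_filter {k : ℕ} (w : Fin k → ι × Bool) :
    holCount w = #{i | (w i).2 = false} := by
  rw [holCount, Finset.card_filter]
  refine Finset.sum_congr rfl fun i _ ↦ ?_
  cases (w i).2 <;> simp

/-- `#dz̄` of a word is the number of its `dz̄`-positions. [folklore] -/
private theorem barCount_eq_card_filter {k : ℕ} (w : Fin k → ι × Bool) :
    barCount w = #{i | (w i).2 = true} := by
  rw [barCount, Finset.card_filter]

variable [LinearOrder ι]

/-- **Representatives.** Every injective word with `p` letters `dz` and `q` letters `dz̄` is a
reordering of a representative word `appendWord u w` with `u`, `w` strictly increasing (sort the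
`dz`-letters and the `dz̄`-letters separately). [cite: Lange2023AbelianVarietiesComplex, §1.1.5 Prop. 1.1.23 (PDF p. 25)] -/
theorem exists_appendWord_perm {p q : ℕ} (w : Fin (p + q) → ι × Bool) (hw : Injective w)
    (hp : holCount w = p) (hq : barCount w = q) :
    ∃ (u : Fin p → ι) (w' : Fin q → ι), StrictMono u ∧ StrictMono w' ∧
      ∃ π : Equiv.Perm (Fin (p + q)), appendWord u w' = w ∘ π := by
  classical
  -- the `dz`-letters `F` and the `dz̄`-letters `T`
  set F : Finset ι := (univ.filter fun i ↦ (w i).2 = false).image fun i ↦ (w i).1 with hF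
  set T : Finset ι := (univ.filter fun i ↦ (w i).2 = true).image fun i ↦ (w i).1 with hT
  have hinjF : Set.InjOn (fun i ↦ (w i).1) ↑(univ.filter fun i ↦ (w i).2 = false) := by
    intro i hi j hj hij
    simp only [coe_filter, mem_univ, true_and, Set.mem_setOf_eq] at hi hj
    exact hw (Prod.ext hij (by rw [hi, hj]))
  have hinjT : Set.InjOn (fun i ↦ (w i).1) ↑(univ.filter fun i ↦ (w i).2 = true) := by
    intro i hi j hj hij
    simp only [coe_filter, mem_univ, true_and, Set.mem_setOf_eq] at hi hj
    exact hw (Prod.ext hij (by rw [hi, hj]))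
  have hFcard : F.card = p := by
    rw [hF, card_image_of_injOn hinjF, ← holCount_eq_card_filter, hp]
  have hTcard : T.card = q := by
    rw [hT, card_image_of_injOn hinjT, ← barCount_eq_card_filter, hq]
  refine ⟨F.orderEmbOfFin hFcard, T.orderEmbOfFin hTcard, (F.orderEmbOfFin hFcard).strictMono,
    (T.orderEmbOfFin hTcard).strictMono, ?_⟩
  set a := appendWord (ι := ι) (F.orderEmbOfFin hFcard) (T.orderEmbOfFin hTcard) with ha
  -- every letter of `a` is a letter of `w`
  have hsurj : ∀ i, ∃ j, w j = a i := by
    intro i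
    refine Fin.addCases (fun i₁ ↦ ?_) (fun i₂ ↦ ?_) i
    · have hmem : (F.orderEmbOfFin hFcard) i₁ ∈
          (univ.filter fun i ↦ (w i).2 = false).image fun i ↦ (w i).1 :=
        Finset.orderEmbOfFin_mem F hFcard i₁
      rw [mem_image] at hmem
      obtain ⟨j, hj, hj'⟩ := hmem
      simp only [mem_filter, mem_univ, true_and] at hj
      exact ⟨j, by rw [ha, appendWord_castAdd, ← hj', ← hj]⟩
    · have hmem : (T.orderEmbOfFin hTcard) i₂ ∈
          (univ.filter fun i ↦ (w i).2 = true).image fun i ↦ (w i).1 :=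
        Finset.orderEmbOfFin_mem T hTcard i₂
      rw [mem_image] at hmem
      obtain ⟨j, hj, hj'⟩ := hmem
      simp only [mem_filter, mem_univ, true_and] at hj
      exact ⟨j, by rw [ha, appendWord_natAdd, ← hj', ← hj]⟩
  choose f hf using hsurj
  -- and conversely, so `f` is surjective, hence a permutation
  have hfsurj : Surjective f := by
    intro j
    rcases hb : (w j).2 with _ | _
    · have hmem : (w j).1 ∈ Set.range (F.orderEmbOfFin hFcard) := by
        rw [Finset.range_orderEmbOfFin, hF, coe_image, coe_filter]
        exact ⟨j, by simpa using hb, rfl⟩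
      obtain ⟨i₁, hi₁⟩ := hmem
      refine ⟨Fin.castAdd q i₁, hw ?_⟩
      rw [hf, ha, appendWord_castAdd, hi₁]
      exact Prod.ext rfl hb.symm
    · have hmem : (w j).1 ∈ Set.range (T.orderEmbOfFin hTcard) := by
        rw [Finset.range_orderEmbOfFin, hT, coe_image, coe_filter]
        exact ⟨j, by simpa using hb, rfl⟩
      obtain ⟨i₂, hi₂⟩ := hmem
      refine ⟨Fin.natAdd p i₂, hw ?_⟩
      rw [hf, ha, appendWord_natAdd, hi₂]
      exact Prod.ext rfl hb.symm
  refine ⟨Equiv.ofBijective f (Finite.surjective_iff_bijective.1 hfsurj), ?_⟩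
  funext i
  simp only [comp_apply, Equiv.ofBijective_apply, hf]

end Words

/-! ### The span by representative monomials and the upper bound -/

section UpperBound

variable {E : Type*} [NormedAddCommGroup E] [NormedSpace ℂ E] {ι : Type*} [Fintype ι]
  [LinearOrder ι] (φ : ι → (E →L[ℂ] ℂ)) {v : ι → E}

/-- **`Λ^{p,q}` is spanned by the representative monomials `dz_U ∧ dz̄_W`**, `U`, `W` increasing
(Lange–Birkenhake: "an element of `IF^{p,q}` is of the form `Σ_{#I=p,#J=q} α_{IJ} dv_I ∧ dv̄_J`").
[cite: Lange2023AbelianVarietiesComplex, §1.1.5 Thm. 1.1.21 (b) and Prop. 1.1.23 (PDF pp. 25–26)] -/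
theorem typeSubmodule_eq_span_pqWord_appendWord
    (hφv : ∑ j, (φ j).smulRight (v j) = ContinuousLinearMap.id ℂ E) (p q : ℕ) :
    typeSubmodule E (p + q) p q = Submodule.span ℂ (pqWord φ (p + q) ''
      {a | ∃ (u : Fin p → ι) (w : Fin q → ι), StrictMono u ∧ StrictMono w ∧ appendWord u w = a}) := by
  rw [typeSubmodule_eq_span_pqWord φ hφv]
  change Submodule.span ℂ (wedgeWord (pqLetter φ) (oneForm₀ E) (p + q) '' _) =
    Submodule.span ℂ (wedgeWord (pqLetter φ) (oneForm₀ E) (p + q) '' _)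
  refine span_wedgeWord_image_eq_of_representatives (pqLetter φ) (oneForm₀ E) ?_ ?_
  · rintro _ ⟨u, w, -, -, rfl⟩
    exact ⟨holCount_appendWord u w, barCount_appendWord u w⟩
  · rintro w ⟨hp, hq⟩ hinj
    obtain ⟨u, w', hu, hw', π, hπ⟩ := exists_appendWord_perm w hinj hp hq
    exact ⟨appendWord u w', ⟨u, w', hu, hw', rfl⟩, π, hπ⟩

/-- **Upper bound `dim_ℂ Λ^{p,q} ≤ C(|ι|,p)·C(|ι|,q)`** for a complex frame indexed by `ι`: there are
at most that many representative monomials. [cite: Lange2023AbelianVarietiesComplex, §1.1.5 Lemma 1.1.22 and Prop. 1.1.23 (PDF pp. 25–26)] -/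
theorem finrank_typeSubmodule_le
    (hφv : ∑ j, (φ j).smulRight (v j) = ContinuousLinearMap.id ℂ E) {k p q : ℕ} (hpq : p + q = k) :
    finrank ℂ (typeSubmodule E k p q) ≤ (Fintype.card ι).choose p * (Fintype.card ι).choose q := by
  classical
  subst hpq
  set R : Finset (Fin (p + q) → ι × Bool) :=
    (univ : Finset ({u : Fin p → ι // StrictMono u} × {w : Fin q → ι // StrictMono w})).image
      fun x ↦ appendWord x.1.1 x.2.1 with hR
  have hRset : {a : Fin (p + q) → ι × Bool | ∃ (u : Fin p → ι) (w : Fin q → ι),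
      StrictMono u ∧ StrictMono w ∧ appendWord u w = a} = ↑R := by
    ext a
    simp only [Set.mem_setOf_eq, hR, coe_image, coe_univ, Set.image_univ, Set.mem_range,
      Prod.exists, Subtype.exists, exists_prop]
    constructor
    · rintro ⟨u, w, hu, hw, rfl⟩
      exact ⟨u, hu, w, hw, rfl⟩
    · rintro ⟨u, hu, w, hw, rfl⟩
      exact ⟨u, w, hu, hw, rfl⟩
  rw [typeSubmodule_eq_span_pqWord_appendWord φ hφv p q, hRset, ← coe_image]
  have hspan : Set.finrank ℂ (↑(R.image (pqWord φ (p + q))) : Set (E [⋀^Fin (p + q)]→L[ℝ] ℂ)) ≤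
      (R.image (pqWord φ (p + q))).card :=
    finrank_span_finset_le_card (R := ℂ) (R.image (pqWord φ (p + q)))
  calc finrank ℂ (Submodule.span ℂ (↑(R.image (pqWord φ (p + q))) : Set (E [⋀^Fin (p + q)]→L[ℝ] ℂ)))
      ≤ (R.image (pqWord φ (p + q))).card := hspan
    _ ≤ R.card := card_image_le
    _ ≤ (univ : Finset ({u : Fin p → ι // StrictMono u} × {w : Fin q → ι // StrictMono w})).card :=
        card_image_le
    _ = (Fintype.card ι).choose p * (Fintype.card ι).choose q := by
        rw [card_univ, Fintype.card_prod, card_strictMono_eq_choose', card_strictMono_eq_choose']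

end UpperBound

/-! ### The dimension of `Alt^k_ℝ(E; ℂ)` and the squeeze -/

section Main

variable (E : Type*) [NormedAddCommGroup E] [NormedSpace ℂ E] [FiniteDimensional ℂ E]

/-- **`dim_ℂ Alt^k_ℝ(E; ℂ) = C(2g, k)`**, `g = dim_ℂ E` (Lange–Birkenhake, Cor. 1.1.19 / Prop. 1.1.20
pointwise: `Alt^n_ℝ(V, ℂ) = ⋀ⁿ Hom_ℝ(V, ℂ)` has the basis `dx_{i₁} ∧ ⋯ ∧ dx_{iₙ}`, `i₁ < ⋯ < iₙ`,
`dim_ℝ V = 2g`): the tree's basis of increasing monomials of a real dual frame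
(`LinearAlgebra.Alternating.finrank_eq_card_strictMono`) for the coordinate frame of a real basis
of `E`. [cite: Lange2023AbelianVarietiesComplex, §1.1.3 Cor. 1.1.19 and §1.1.4 Prop. 1.1.20 (PDF pp. 23–24)] -/
theorem finrank_alt_real_complex (k : ℕ) :
    finrank ℂ (E [⋀^Fin k]→L[ℝ] ℂ) = (2 * finrank ℂ E).choose k := by
  classical
  set b := Module.finBasis ℝ E with hb
  have hdual : ∀ i j, (b.coord i).toContinuousLinearMap (b j) = if i = j then (1 : ℝ) else 0 := by
    intro i j
    rw [LinearMap.coe_toContinuousLinearMap', Module.Basis.coord_apply, Module.Basis.repr_self,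
      Finsupp.single_apply]
    by_cases h : i = j
    · rw [if_pos h, if_pos h.symm]
    · rw [if_neg h, if_neg (Ne.symm h)]
  have hframe : ∑ i, ((b.coord i).toContinuousLinearMap).smulRight (b i) =
      ContinuousLinearMap.id ℝ E := by
    ext x
    simp only [_root_.sum_apply, ContinuousLinearMap.smulRight_apply,
      LinearMap.coe_toContinuousLinearMap', Module.Basis.coord_apply, ContinuousLinearMap.coe_id',
      id_eq]
    exact b.sum_repr x
  rw [finrank_eq_card_strictMono (𝕜' := ℂ) (fun i ↦ (b.coord i).toContinuousLinearMap) b hdual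
    hframe k, card_strictMono_eq_choose', Fintype.card_fin, finrank_real_of_complex]

/-- `Alt^k_ℝ(E; ℂ)` is finite-dimensional over `ℂ` for finite-dimensional `E` (it has the finite
basis of increasing monomials of a real dual frame). [folklore] -/
private theorem finite_alt_real_complex (k : ℕ) : Module.Finite ℂ (E [⋀^Fin k]→L[ℝ] ℂ) := by
  classical
  set b := Module.finBasis ℝ E
  have hdual : ∀ i j, (b.coord i).toContinuousLinearMap (b j) = if i = j then (1 : ℝ) else 0 := by
    intro i j
    rw [LinearMap.coe_toContinuousLinearMap', Module.Basis.coord_apply, Module.Basis.repr_self,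
      Finsupp.single_apply]
    by_cases h : i = j
    · rw [if_pos h, if_pos h.symm]
    · rw [if_neg h, if_neg (Ne.symm h)]
  have hframe : ∑ i, ((b.coord i).toContinuousLinearMap).smulRight (b i) =
      ContinuousLinearMap.id ℝ E := by
    ext x
    simp only [_root_.sum_apply, ContinuousLinearMap.smulRight_apply,
      LinearMap.coe_toContinuousLinearMap', Module.Basis.coord_apply, ContinuousLinearMap.coe_id',
      id_eq]
    exact b.sum_repr x
  exact Module.Finite.of_basis (frameWordBasis (𝕜' := ℂ)
    (fun i ↦ (b.coord i).toContinuousLinearMap) b hdual hframe k)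

/-- **`∑_{p+q=k} dim_ℂ Λ^{p,q}(E) = C(2g, k)`**: the type decomposition
`Alt^k_ℝ(E; ℂ) = ⨁_{p+q=k} Λ^{p,q}` (`isInternal_typeSubmodule`) and `finrank_alt_real_complex`.
[cite: Lange2023AbelianVarietiesComplex, §1.1.5 Prop. 1.1.23 (PDF pp. 25–26)] [cite: Voisin2002, §2.3.1 eq. (2.4)] -/
theorem sum_finrank_typeSubmodule (k : ℕ) :
    ∑ pq ∈ antidiagonal k, finrank ℂ (typeSubmodule E k pq.1 pq.2) = (2 * finrank ℂ E).choose k := by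
  haveI := finite_alt_real_complex E k
  haveI : ∀ pq : ↥(antidiagonal k), Module.Free ℂ (typeSubmodule E k pq.1.1 pq.1.2) := fun pq ↦
    Module.Free.of_divisionRing ℂ ↥(typeSubmodule E k pq.1.1 pq.1.2)
  haveI : ∀ pq : ↥(antidiagonal k), Module.Finite ℂ (typeSubmodule E k pq.1.1 pq.1.2) :=
    fun _ ↦ inferInstance
  let e := LinearEquiv.ofBijective
    (DirectSum.coeLinearMap fun pq : ↥(antidiagonal k) ↦ typeSubmodule E k pq.1.1 pq.1.2)
    (isInternal_typeSubmodule (E := E) (k := k))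
  rw [← finrank_alt_real_complex E k, ← e.finrank_eq, Module.finrank_directSum,
    ← Finset.sum_coe_sort (antidiagonal k)]

variable {E}

/-- **`dim_ℂ Λ^{p,q}(E) = C(g,p)·C(g,q)` for `p + q = k`, `g = dim_ℂ E`** — the pointwise Hodge numbers
(Lange–Birkenhake (1992), Thm. 1.1.21 (b) / Lemma 1.1.22 / Prop. 1.1.23: `IF^{p,q} ≅ ⋀ᵖΩ ⊗ ⋀^qΩ̄`,
`rank Ω^p_X = C(g,p)`; Voisin (2002), §2.3.1 eq. (2.4)). Squeeze: termwise `≤` by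
`finrank_typeSubmodule_le` for the coordinate frame of a complex basis, equal sums by
`sum_finrank_typeSubmodule` and Vandermonde.
[cite: Lange2023AbelianVarietiesComplex, §1.1.5 Lemma 1.1.22 and Prop. 1.1.23 (PDF pp. 25–26)] [cite: Voisin2002, §2.3.1 eq. (2.4)] -/
theorem finrank_typeSubmodule {k p q : ℕ} (hpq : p + q = k) :
    finrank ℂ (typeSubmodule E k p q) = (finrank ℂ E).choose p * (finrank ℂ E).choose q := by
  classical
  -- the coordinate frame of a complex basis
  set bC := Module.finBasis ℂ E with hbC
  have hφv : ∑ j, ((bC.coord j).toContinuousLinearMap).smulRight (bC j) =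
      ContinuousLinearMap.id ℂ E := by
    ext x
    simp only [_root_.sum_apply, ContinuousLinearMap.smulRight_apply,
      LinearMap.coe_toContinuousLinearMap', Module.Basis.coord_apply, ContinuousLinearMap.coe_id',
      id_eq]
    exact bC.sum_repr x
  have hle : ∀ pq ∈ antidiagonal k, finrank ℂ (typeSubmodule E k pq.1 pq.2) ≤
      (finrank ℂ E).choose pq.1 * (finrank ℂ E).choose pq.2 := by
    intro pq hpq'
    have h := finrank_typeSubmodule_le (fun j ↦ (bC.coord j).toContinuousLinearMap) hφv
      (mem_antidiagonal.1 hpq')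
    rwa [Fintype.card_fin] at h
  have hsum : ∑ pq ∈ antidiagonal k, finrank ℂ (typeSubmodule E k pq.1 pq.2) =
      ∑ pq ∈ antidiagonal k, (finrank ℂ E).choose pq.1 * (finrank ℂ E).choose pq.2 := by
    rw [sum_finrank_typeSubmodule, two_mul, Nat.add_choose_eq]
  exact (Finset.sum_eq_sum_iff_of_le hle).1 hsum (p, q) (mem_antidiagonal.2 hpq)

end Main

end Literature.Analysis.Complex

end
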